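import Summits.AnomalousDissipation.AnomalousDissipation.Theorems.TaylorCertificatesKolmogorovFloorResponseDefs
import Literature.Analysis.FunctionSpaces.TorusFourierModes
import Literature.Analysis.FluidPDE.NSGalerkinFourier

/-!
# The integer-amplitude Kolmogorov shear on the Fourier side (DICTIONARY of line `Sketch`,
crux KolmogorovFloor; conjuncts (D1), (D2))

For `ξ, e ∈ ℤ³` with `ξ ≠ 0`, `ξ · e = 0`, the shear `U(x) = sin(2π ξ·x) e` is the real
trigonometric polynomial `shearField R ξ e` with coefficients `shearCoeff ξ e`
(`Û(±ξ) = ∓(i/2) e`). This file proves: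

* (D1) `shearField_facts`: `U` is smooth, solenoidal, mean zero, an exact steady Euler state
  `(U·∇)U = 0`, with coefficients `shearCoeff`, energy `∫‖U‖² = (e·e)/2` and enstrophy
  `2π² (ξ·ξ)(e·e)`;
* (D2) `fc_linearisedTransport`: for a real trigonometric polynomial `b = realTrigPoly (ball R) C`,
  the Fourier coefficients of `(U·∇)b + (b·∇)U` are `linOp ξ e C`.
-/

noncomputable section

set_option linter.dupNamespace false

open MeasureTheory Matrix Finset UnitAddTorus
open scoped BigOperators ComplexConjugate InnerProductSpace

namespace Summit.AnomalousDissipation.AnomalousDissipation.Theorems.KolmogorovFloor.Response.Dictionary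

open Literature.Analysis.FunctionSpaces Literature.Analysis.FluidPDE

/-! ### The shear coefficients -/

/-- A nonzero integer frequency is not its own negative. -/
theorem self_ne_neg {ξ : Fin 3 → ℤ} (hξ : ξ ≠ 0) : ξ ≠ -ξ := by
  intro h
  apply hξ
  funext i
  have hi := congr_fun h i
  simp only [Pi.neg_apply] at hi
  simp only [Pi.zero_apply]
  omega

/-- `Û(ξ) = −(i/2) e`. -/
theorem shearCoeff_self (ξ e : Fin 3 → ℤ) : shearCoeff ξ e ξ = (-(Complex.I / 2)) • Torus.freqVec e := by
  rw [shearCoeff, if_pos rfl]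

/-- `Û(−ξ) = (i/2) e` (`ξ ≠ 0`). -/
theorem shearCoeff_neg_self {ξ : Fin 3 → ℤ} (hξ : ξ ≠ 0) (e : Fin 3 → ℤ) :
    shearCoeff ξ e (-ξ) = (Complex.I / 2) • Torus.freqVec e := by
  rw [shearCoeff, if_neg (self_ne_neg hξ).symm, if_pos rfl]

/-- `Û(κ) = 0` off `{ξ, −ξ}`. -/
theorem shearCoeff_of_ne {ξ κ : Fin 3 → ℤ} (e : Fin 3 → ℤ) (h1 : κ ≠ ξ) (h2 : κ ≠ -ξ) :
    shearCoeff ξ e κ = 0 := by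
  rw [shearCoeff, if_neg h1, if_neg h2]

/-- `Û(0) = 0` (`ξ ≠ 0`). -/
theorem shearCoeff_zero {ξ : Fin 3 → ℤ} (hξ : ξ ≠ 0) (e : Fin 3 → ℤ) : shearCoeff ξ e 0 = 0 :=
  shearCoeff_of_ne e (Ne.symm hξ) (fun h => hξ (neg_eq_zero.1 h.symm))

/-- Every shear coefficient is a complex multiple of `e`. -/
theorem exists_shearCoeff_eq_smul (ξ e κ : Fin 3 → ℤ) : ∃ s : ℂ, shearCoeff ξ e κ = s • Torus.freqVec e := by
  unfold shearCoeff
  split_ifs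
  exacts [⟨_, rfl⟩, ⟨_, rfl⟩, ⟨0, (zero_smul _ _).symm⟩]

/-- The pairing of a multiple of `e` with a frequency: `(s e) · m = s (e · m)`. -/
theorem sum_smul_freqVec_mul (s : ℂ) (e m : Fin 3 → ℤ) :
    ∑ j, (s • Torus.freqVec e) j * (m j : ℂ) = s * ((e ⬝ᵥ m : ℤ) : ℂ) := by
  simp only [PiLp.smul_apply, Torus.freqVec_apply, smul_eq_mul, dotProduct, Int.cast_sum, Int.cast_mul,
    Finset.mul_sum]
  exact Finset.sum_congr rfl fun j _ => by ring

/-- The pairing of a frequency with a multiple of `e`: `κ · (s e) = s (κ · e)`. -/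
theorem sum_mul_smul_freqVec (s : ℂ) (κ e : Fin 3 → ℤ) :
    ∑ j, (κ j : ℂ) * (s • Torus.freqVec e) j = s * ((κ ⬝ᵥ e : ℤ) : ℂ) := by
  simp only [PiLp.smul_apply, Torus.freqVec_apply, smul_eq_mul, dotProduct, Int.cast_sum, Int.cast_mul,
    Finset.mul_sum]
  exact Finset.sum_congr rfl fun j _ => by ring

/-- The shear pairs trivially with its own frequencies: `Û(l) · (±ξ) = 0` for every `l` (`ξ · e = 0`). -/
theorem sum_shearCoeff_mul_eq_zero {ξ e m : Fin 3 → ℤ} (hξe : ξ ⬝ᵥ e = 0) (hm : m = ξ ∨ m = -ξ)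
    (l : Fin 3 → ℤ) : ∑ j, shearCoeff ξ e l j * (m j : ℂ) = 0 := by
  have hem : e ⬝ᵥ m = 0 := by
    rcases hm with rfl | rfl
    · rw [dotProduct_comm, hξe]
    · rw [dotProduct_neg, dotProduct_comm, hξe, neg_zero]
  obtain ⟨s, hs⟩ := exists_shearCoeff_eq_smul ξ e l
  rw [hs, sum_smul_freqVec_mul, hem, Int.cast_zero, mul_zero]

/-- The shear coefficients are transversal: `κ · Û(κ) = 0` for every `κ` (`ξ · e = 0`). -/
theorem sum_mul_shearCoeff_eq_zero {ξ e : Fin 3 → ℤ} (hξe : ξ ⬝ᵥ e = 0) (κ : Fin 3 → ℤ) :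
    ∑ j, (κ j : ℂ) * shearCoeff ξ e κ j = 0 := by
  by_cases h : κ = ξ ∨ κ = -ξ
  · have hκe : κ ⬝ᵥ e = 0 := by
      rcases h with rfl | rfl
      · exact hξe
      · rw [neg_dotProduct, hξe, neg_zero]
    obtain ⟨s, hs⟩ := exists_shearCoeff_eq_smul ξ e κ
    rw [hs, sum_mul_smul_freqVec, hκe, Int.cast_zero, mul_zero]
  · rw [not_or] at h
    rw [shearCoeff_of_ne e h.1 h.2]
    simp

/-- The shear coefficients are conjugate symmetric (`ξ ≠ 0`; `e` is real, `conj(−i/2) = i/2`). -/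
theorem isConjSymm_shearCoeff {ξ : Fin 3 → ℤ} (hξ : ξ ≠ 0) (e : Fin 3 → ℤ) :
    Torus.IsConjSymm (shearCoeff ξ e) := by
  intro κ
  by_cases h1 : κ = ξ
  · subst h1
    rw [shearCoeff_neg_self hξ, shearCoeff_self, EuclideanSpace.conjVec_smul, Torus.conjVec_freqVec]
    congr 1
    rw [map_neg, map_div₀, Complex.conj_I, map_ofNat, neg_div, neg_neg]
  · by_cases h2 : κ = -ξ
    · subst h2
      rw [neg_neg, shearCoeff_self, shearCoeff_neg_self hξ, EuclideanSpace.conjVec_smul,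
        Torus.conjVec_freqVec]
      congr 1
      rw [map_div₀, Complex.conj_I, map_ofNat, neg_div]
    · have h1' : -κ ≠ ξ := fun h => h2 (by rw [← h, neg_neg])
      have h2' : -κ ≠ -ξ := fun h => h1 (neg_injective h)
      rw [shearCoeff_of_ne e h1' h2', shearCoeff_of_ne e h1 h2, EuclideanSpace.conjVec_zero]

/-- The shear coefficients are transversal on every frequency set (`ξ · e = 0`). -/
theorem isTransversal_shearCoeff (S : Finset (Fin 3 → ℤ)) {ξ e : Fin 3 → ℤ} (hξe : ξ ⬝ᵥ e = 0) :
    Torus.IsTransversal S (shearCoeff ξ e) :=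
  fun κ _ => sum_mul_shearCoeff_eq_zero hξe κ

/-- A sum over `S ∋ ±ξ` of a family supported on `{ξ, −ξ}` (`ξ ≠ 0`) has two terms. -/
theorem sum_eq_of_support_pair {M : Type*} [AddCommMonoid M] {S : Finset (Fin 3 → ℤ)}
    {ξ : Fin 3 → ℤ} (hξ : ξ ≠ 0) (h1 : ξ ∈ S) (h2 : -ξ ∈ S) (f : (Fin 3 → ℤ) → M)
    (hf : ∀ κ, κ ≠ ξ → κ ≠ -ξ → f κ = 0) : ∑ κ ∈ S, f κ = f ξ + f (-ξ) := by
  rw [← Finset.sum_pair (self_ne_neg hξ)]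
  refine (Finset.sum_subset ?_ fun κ _ hκ => ?_).symm
  · intro κ hκ
    simp only [Finset.mem_insert, Finset.mem_singleton] at hκ
    rcases hκ with rfl | rfl <;> assumption
  · simp only [Finset.mem_insert, Finset.mem_singleton, not_or] at hκ
    exact hf κ hκ.1 hκ.2

/-- `|κ|² = κ · κ` as a real number. -/
theorem freqNormSq_eq_dotProduct (κ : Fin 3 → ℤ) : Torus.freqNormSq κ = ((κ ⬝ᵥ κ : ℤ) : ℝ) := by
  simp only [Torus.freqNormSq, dotProduct, Int.cast_sum, Int.cast_mul, sq]

/-- `‖e‖²_{ℂ³} = e · e` for an integer vector. -/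
theorem norm_sq_freqVec (e : Fin 3 → ℤ) : ‖Torus.freqVec e‖ ^ 2 = ((e ⬝ᵥ e : ℤ) : ℝ) := by
  rw [EuclideanSpace.norm_sq_eq, dotProduct, Int.cast_sum]
  refine Finset.sum_congr rfl fun i _ => ?_
  rw [Torus.freqVec_apply, Complex.norm_intCast, sq_abs, Int.cast_mul, sq]

/-- `‖Û(ξ)‖² = (e · e)/4`. -/
theorem norm_sq_shearCoeff_self (ξ e : Fin 3 → ℤ) : ‖shearCoeff ξ e ξ‖ ^ 2 = ((e ⬝ᵥ e : ℤ) : ℝ) / 4 := by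
  rw [shearCoeff_self, norm_smul, mul_pow, norm_sq_freqVec, norm_neg, norm_div, Complex.norm_I,
    Complex.norm_ofNat]
  ring

/-- `‖Û(−ξ)‖² = (e · e)/4` (`ξ ≠ 0`). -/
theorem norm_sq_shearCoeff_neg_self {ξ : Fin 3 → ℤ} (hξ : ξ ≠ 0) (e : Fin 3 → ℤ) :
    ‖shearCoeff ξ e (-ξ)‖ ^ 2 = ((e ⬝ᵥ e : ℤ) : ℝ) / 4 := by
  rw [shearCoeff_neg_self hξ, norm_smul, mul_pow, norm_sq_freqVec, norm_div, Complex.norm_I,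
    Complex.norm_ofNat]
  ring

/-- A field without mean mode has zero mean: `û(0) = complexify (∫ u)`. -/
theorem hasZeroMean_of_fc_zero {u : UnitAddTorus (Fin 3) → EuclideanSpace ℝ (Fin 3)}
    (h0 : mFourierCoeff (EuclideanSpace.complexify ∘ u) 0 = 0) : Torus.HasZeroMean u := by
  have h : mFourierCoeff (EuclideanSpace.complexify ∘ u) 0 = EuclideanSpace.complexify (∫ x, u x) := by
    rw [Torus.mFourierCoeff_eq_integral_volume, neg_zero, mFourier_zero]
    simp only [ContinuousMap.one_apply, one_smul, Function.comp_apply]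
    exact EuclideanSpace.complexify.integral_comp_comm u
  rw [h] at h0
  exact EuclideanSpace.complexify_injective (by rw [h0, map_zero])

/-! ### (D1) The shear facts -/

section ShearFacts

variable {R : ℕ} {ξ e : Fin 3 → ℤ}

/-- The Fourier coefficients of the shear are `shearCoeff` (on and off the ball: `±ξ ∈ ball R`). -/
theorem fc_shearField (hξ : ξ ≠ 0) (hξR : ξ ∈ Torus.freqBall R) (e : Fin 3 → ℤ) (κ : Fin 3 → ℤ) :
    mFourierCoeff (EuclideanSpace.complexify ∘ shearField R ξ e) κ = shearCoeff ξ e κ := by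
  rw [shearField, Torus.mFourierCoeff_realTrigPoly Torus.neg_mem_freqBall_of_mem (isConjSymm_shearCoeff hξ e)]
  by_cases hκ : κ ∈ Torus.freqBall R
  · rw [if_pos hκ]
  · rw [if_neg hκ, shearCoeff_of_ne e (fun h => hκ (by rw [h]; exact hξR))
      (fun h => hκ (by rw [h]; exact Torus.neg_mem_freqBall.2 hξR))]

/-- The shear is an exact steady Euler state: `(U·∇)U = 0` pointwise. -/
theorem convect_shearField_self (hξ : ξ ≠ 0) (hξe : ξ ⬝ᵥ e = 0) (x : UnitAddTorus (Fin 3)) :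
    Torus.convect (shearField R ξ e) (shearField R ξ e) x = 0 := by
  apply EuclideanSpace.complexify_injective
  rw [map_zero, shearField, Torus.complexify_convect_realTrigPoly Torus.neg_mem_freqBall_of_mem
    (isConjSymm_shearCoeff hξ e) (isConjSymm_shearCoeff hξ e) x]
  refine Finset.sum_eq_zero fun l _ => Finset.sum_eq_zero fun m _ => ?_
  by_cases hm : m = ξ ∨ m = -ξ
  · rw [sum_shearCoeff_mul_eq_zero hξe hm l, mul_zero, mul_zero, zero_smul]
  · rw [not_or] at hm
    rw [shearCoeff_of_ne e hm.1 hm.2, smul_zero]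

/-- The energy of the shear: `∫ ‖U‖² = (e · e)/2`. -/
theorem integral_norm_sq_shearField (hξ : ξ ≠ 0) (hξR : ξ ∈ Torus.freqBall R) (e : Fin 3 → ℤ) :
    (∫ x, ‖shearField R ξ e x‖ ^ 2) = ((e ⬝ᵥ e : ℤ) : ℝ) / 2 := by
  rw [shearField,
    Torus.integral_norm_sq_realTrigPoly Torus.neg_mem_freqBall_of_mem (isConjSymm_shearCoeff hξ e),
    sum_eq_of_support_pair hξ hξR (Torus.neg_mem_freqBall.2 hξR) _
      (fun κ h1 h2 => by rw [shearCoeff_of_ne e h1 h2, norm_zero, zero_pow two_ne_zero]),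
    norm_sq_shearCoeff_self, norm_sq_shearCoeff_neg_self hξ]
  ring

/-- The enstrophy of the shear: `‖∇U‖² = 2π² (ξ · ξ)(e · e)`. -/
theorem toReal_eGradNormSq_shearField (hξ : ξ ≠ 0) (hξR : ξ ∈ Torus.freqBall R) (e : Fin 3 → ℤ) :
    (Torus.eGradNormSq (shearField R ξ e)).toReal =
      2 * Real.pi ^ 2 * ((ξ ⬝ᵥ ξ : ℤ) : ℝ) * ((e ⬝ᵥ e : ℤ) : ℝ) := by
  rw [shearField,
    Torus.toReal_eGradNormSq_realTrigPoly Torus.neg_mem_freqBall_of_mem (isConjSymm_shearCoeff hξ e),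
    sum_eq_of_support_pair hξ hξR (Torus.neg_mem_freqBall.2 hξR) _
      (fun κ h1 h2 => by rw [shearCoeff_of_ne e h1 h2, norm_zero, zero_pow two_ne_zero, mul_zero]),
    norm_sq_shearCoeff_self, norm_sq_shearCoeff_neg_self hξ, Torus.freqNormSq_neg, freqNormSq_eq_dotProduct]
  ring

/-- **(D1) Shear facts.** For `ξ ≠ 0`, `ξ · e = 0`, `ξ ∈ ball R`: the shear `U = shearField R ξ e` is
smooth, solenoidal, mean zero, satisfies `(U·∇)U = 0`, has Fourier coefficients `shearCoeff ξ e`,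
energy `(e · e)/2` and enstrophy `2π² (ξ · ξ)(e · e)`. -/
theorem shearField_facts (R : ℕ) (ξ e : Fin 3 → ℤ) (hξ : ξ ≠ 0) (hξe : ξ ⬝ᵥ e = 0)
    (hξR : ξ ∈ Torus.freqBall R) :
    Torus.IsSmooth (shearField R ξ e) ∧ Torus.IsDivFree (shearField R ξ e) ∧
      Torus.HasZeroMean (shearField R ξ e) ∧ (∀ x, Torus.convect (shearField R ξ e) (shearField R ξ e) x = 0) ∧
      (∀ κ, mFourierCoeff (EuclideanSpace.complexify ∘ shearField R ξ e) κ = shearCoeff ξ e κ) ∧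
      (∫ x, ‖shearField R ξ e x‖ ^ 2) = ((e ⬝ᵥ e : ℤ) : ℝ) / 2 ∧
      (Torus.eGradNormSq (shearField R ξ e)).toReal =
        2 * Real.pi ^ 2 * ((ξ ⬝ᵥ ξ : ℤ) : ℝ) * ((e ⬝ᵥ e : ℤ) : ℝ) := by
  refine ⟨Torus.isSmooth_realTrigPoly _ _, Torus.isDivFree_realTrigPoly (isTransversal_shearCoeff _ hξe),
    ?_, convect_shearField_self hξ hξe, fc_shearField hξ hξR e, integral_norm_sq_shearField hξ hξR e,
    toReal_eGradNormSq_shearField hξ hξR e⟩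
  exact hasZeroMean_of_fc_zero (by rw [fc_shearField hξ hξR e, shearCoeff_zero hξ])

end ShearFacts

/-! ### (D2) The linearised transport on the Fourier side -/

section Linearised

variable {S : Finset (Fin 3 → ℤ)} {ξ e : Fin 3 → ℤ} {C : (Fin 3 → ℤ) → EuclideanSpace ℂ (Fin 3)}

/-- The convection symbol `𝓕[(U·∇)b]` against the shear: for `C` vanishing off `S ∋ ±ξ`,
`convectionCoeff S Û C κ = π (κ · e) [C(κ − ξ) − C(κ + ξ)]` (`ξ · e = 0`). -/
theorem convectionCoeff_shear_left (hξ : ξ ≠ 0) (hξe : ξ ⬝ᵥ e = 0) (h1 : ξ ∈ S) (h2 : -ξ ∈ S)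
    (hC0 : ∀ κ, κ ∉ S → C κ = 0) (κ : Fin 3 → ℤ) :
    Torus.convectionCoeff S (shearCoeff ξ e) C κ =
      ((Real.pi : ℂ) * ((κ ⬝ᵥ e : ℤ) : ℂ)) • (C (κ - ξ) - C (κ + ξ)) := by
  rw [Torus.convectionCoeff_def]
  have hinner : ∀ l ∈ S, ∑ m ∈ S, (if l + m = κ then
      (2 * Real.pi * Complex.I * ∑ j, shearCoeff ξ e l j * (m j : ℂ)) • C m else 0) =
      (2 * Real.pi * Complex.I * ∑ j, shearCoeff ξ e l j * ((κ - l) j : ℂ)) • C (κ - l) := by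
    intro l _
    have hcond : ∀ m, (l + m = κ) = (m = κ - l) := fun m =>
      propext (by rw [eq_sub_iff_add_eq, add_comm])
    simp_rw [hcond, Finset.sum_ite_eq']
    split_ifs with hm
    · rfl
    · rw [hC0 _ hm, smul_zero]
  rw [Finset.sum_congr rfl hinner, sum_eq_of_support_pair hξ h1 h2 _ (fun l hl1 hl2 => by
      rw [shearCoeff_of_ne e hl1 hl2]; simp),
    shearCoeff_self, shearCoeff_neg_self hξ, sum_smul_freqVec_mul, sum_smul_freqVec_mul, sub_neg_eq_add,
    dotProduct_sub, dotProduct_add, dotProduct_comm e ξ, hξe, sub_zero, add_zero, dotProduct_comm e κ]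
  have hR : ((Real.pi : ℂ) * ((κ ⬝ᵥ e : ℤ) : ℂ)) • (C (κ - ξ) - C (κ + ξ)) =
      ((Real.pi : ℂ) * ((κ ⬝ᵥ e : ℤ) : ℂ)) • C (κ - ξ) +
        (-((Real.pi : ℂ) * ((κ ⬝ᵥ e : ℤ) : ℂ))) • C (κ + ξ) := by
    rw [smul_sub, neg_smul]; exact sub_eq_add_neg _ _
  rw [hR]
  congr 1
  · congr 1
    linear_combination (-((Real.pi : ℂ) * ((κ ⬝ᵥ e : ℤ) : ℂ))) * Complex.I_mul_I
  · congr 1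
    linear_combination ((Real.pi : ℂ) * ((κ ⬝ᵥ e : ℤ) : ℂ)) * Complex.I_mul_I

/-- The convection symbol `𝓕[(b·∇)U]` of the shear: for `C` vanishing off `S ∋ ±ξ`,
`convectionCoeff S C Û κ = π [ξ · C(κ − ξ) + ξ · C(κ + ξ)] e`. -/
theorem convectionCoeff_shear_right (hξ : ξ ≠ 0) (h1 : ξ ∈ S) (h2 : -ξ ∈ S)
    (hC0 : ∀ κ, κ ∉ S → C κ = 0) (e κ : Fin 3 → ℤ) :
    Torus.convectionCoeff S C (shearCoeff ξ e) κ =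
      ((Real.pi : ℂ) * (ipair ξ (C (κ - ξ)) + ipair ξ (C (κ + ξ)))) • Torus.freqVec e := by
  rw [Torus.convectionCoeff_def, Finset.sum_comm]
  have hinner : ∀ m ∈ S, ∑ l ∈ S, (if l + m = κ then
      (2 * Real.pi * Complex.I * ∑ j, C l j * (m j : ℂ)) • shearCoeff ξ e m else 0) =
      (2 * Real.pi * Complex.I * ∑ j, C (κ - m) j * (m j : ℂ)) • shearCoeff ξ e m := by
    intro m _
    have hcond : ∀ l, (l + m = κ) = (l = κ - m) := fun l => propext eq_sub_iff_add_eq.symm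
    simp_rw [hcond, Finset.sum_ite_eq']
    split_ifs with hl
    · rfl
    · rw [hC0 _ hl]; simp
  rw [Finset.sum_congr rfl hinner, sum_eq_of_support_pair hξ h1 h2 _ (fun m hm1 hm2 => by
      rw [shearCoeff_of_ne e hm1 hm2, smul_zero]),
    shearCoeff_self, shearCoeff_neg_self hξ, smul_smul, smul_smul, ← add_smul, sub_neg_eq_add]
  congr 1
  have hA : ∑ j, C (κ - ξ) j * (ξ j : ℂ) = ipair ξ (C (κ - ξ)) := by
    unfold ipair; exact Finset.sum_congr rfl fun j _ => mul_comm _ _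
  have hB : ∑ j, C (κ + ξ) j * ((-ξ) j : ℂ) = -ipair ξ (C (κ + ξ)) := by
    unfold ipair
    rw [← Finset.sum_neg_distrib]
    exact Finset.sum_congr rfl fun j _ => by rw [Pi.neg_apply, Int.cast_neg]; ring
  rw [hA, hB]
  linear_combination (-((Real.pi : ℂ) * (ipair ξ (C (κ - ξ)) + ipair ξ (C (κ + ξ))))) * Complex.I_mul_I

/-- Fourier coefficients of a sum of integrable functions (cf. `Torus.mFourierCoeff_sub`). -/
theorem fc_add_of_integrable {f g : UnitAddTorus (Fin 3) → EuclideanSpace ℂ (Fin 3)} (hf : Integrable f volume)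
    (hg : Integrable g volume) (k : Fin 3 → ℤ) :
    mFourierCoeff (f + g) k = mFourierCoeff f k + mFourierCoeff g k := by
  simp only [Torus.mFourierCoeff_eq_integral_volume, Pi.add_apply, smul_add]
  exact integral_add (Torus.integrable_mFourier_smul' hf k) (Torus.integrable_mFourier_smul' hg k)

/-- **(D2) The linearised transport on the Fourier side.** For `ξ ≠ 0`, `ξ · e = 0`, `ξ ∈ ball R`,
a conjugate-symmetric `C` vanishing off `ball R`, `U = shearField R ξ e` and
`b = realTrigPoly (ball R) C`: `𝓕[(U·∇)b + (b·∇)U](κ) = linOp ξ e C κ` for every `κ`. -/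
theorem fc_linearisedTransport (R : ℕ) (ξ e : Fin 3 → ℤ) (C : (Fin 3 → ℤ) → EuclideanSpace ℂ (Fin 3))
    (hξ : ξ ≠ 0) (hξe : ξ ⬝ᵥ e = 0) (hξR : ξ ∈ Torus.freqBall R) (hC : Torus.IsConjSymm C)
    (hC0 : ∀ κ, κ ∉ Torus.freqBall R → C κ = 0) (κ : Fin 3 → ℤ) :
    mFourierCoeff (EuclideanSpace.complexify ∘ fun x =>
      Torus.convect (shearField R ξ e) (Torus.realTrigPoly (Torus.freqBall R) C) x +
      Torus.convect (Torus.realTrigPoly (Torus.freqBall R) C) (shearField R ξ e) x) κ = linOp ξ e C κ := by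
  have hS : ∀ k ∈ Torus.freqBall (d := Fin 3) R, -k ∈ Torus.freqBall R := Torus.neg_mem_freqBall_of_mem
  have hU : Torus.IsSmooth (shearField R ξ e) := Torus.isSmooth_realTrigPoly _ _
  have hb : Torus.IsSmooth (Torus.realTrigPoly (Torus.freqBall R) C) := Torus.isSmooth_realTrigPoly _ _
  have hsplit : (EuclideanSpace.complexify ∘ fun x =>
      Torus.convect (shearField R ξ e) (Torus.realTrigPoly (Torus.freqBall R) C) x +
      Torus.convect (Torus.realTrigPoly (Torus.freqBall R) C) (shearField R ξ e) x) =
      (EuclideanSpace.complexify ∘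
          Torus.convect (shearField R ξ e) (Torus.realTrigPoly (Torus.freqBall R) C)) +
        (EuclideanSpace.complexify ∘
          Torus.convect (Torus.realTrigPoly (Torus.freqBall R) C) (shearField R ξ e)) := by
    funext x; simp only [Function.comp_apply, Pi.add_apply, map_add]
  rw [hsplit, fc_add_of_integrable (Torus.integrable_complexify_comp (hU.convect hb).integrable)
    (Torus.integrable_complexify_comp (hb.convect hU).integrable)]
  unfold shearField
  rw [Torus.mFourierCoeff_convect_realTrigPoly hS (isConjSymm_shearCoeff hξ e) hC,
    Torus.mFourierCoeff_convect_realTrigPoly hS hC (isConjSymm_shearCoeff hξ e),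
    convectionCoeff_shear_left hξ hξe hξR (Torus.neg_mem_freqBall.2 hξR) hC0,
    convectionCoeff_shear_right hξ hξR (Torus.neg_mem_freqBall.2 hξR) hC0]
  rfl

end Linearised

end Summit.AnomalousDissipation.AnomalousDissipation.Theorems.KolmogorovFloor.Response.Dictionary
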